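import Summits.ValiantsHypothesis.ValiantsHypothesis.Theorems.BarrierLeverTransversalMinorLayoutsEightFacesFour

/-!
# Route BarrierLever — item `TransversalLayoutsRankLeEight` (stmt-ValiantsHypothesis-19933):
# eight-face complexes without vertices of degree two and four — the triangle graph plus a point

Helper file (`--supports stmt-ValiantsHypothesis-19933`; cell valiant-natproofs, rung V4, 𝒟-side of
door (c); seat val-np-p1 gen 8).  Partner classifications for the locked cell `(4, 8)` (the full
side is the `4`-path with class sizes `2, 3, 5, 6`, or the `3`-star with class sizes `2, 4, 6`):

* `lowerFamily_eight_no_degree_two_three`: a lower family of eight sets with a member of size `≥ 2`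
  and no element of degree two or three is a SOLID TRIANGLE (a pair member `{a, b}` would put `a`
  and `b` in `≥ 4` members each, too many);
* `lowerFamily_eight_no_degree_two_four`: a lower family of eight sets with a member of size `≥ 2`
  and no element of degree two or four is the TRIANGLE GRAPH PLUS A POINT
  `∅, a, b, c, ab, ac, bc, d`.

WHAT THIS IS NOT: bookkeeping for a bounded-rank slice of TT; nothing on TT / item 19761 in
general, on crux stmt-ValiantsHypothesis-14610, or on `VP` versus `VNP`.
-/

-- layout Summits/ValiantsHypothesis/ValiantsHypothesis forces the duplicated namespace component
set_option linter.dupNamespace false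

open Matrix Finset

namespace Summit.ValiantsHypothesis.ValiantsHypothesis.Theorems.BarrierLever.FiniteCheck

open Summit.ValiantsHypothesis.ValiantsHypothesis.Theorems.BarrierLever.Compression

/-- A lower family of exactly eight sets with a member of size `≥ 2` and no element lying in exactly
two or exactly four members is the TRIANGLE GRAPH PLUS A POINT `∅, a, b, c, ab, ac, bc, d`
(membership form). -/
theorem lowerFamily_eight_no_degree_two_four {h : ℕ} (F : Finset (Finset (Fin h)))
    (hlow : ∀ x ∈ F, ∀ t, t ⊆ x → t ∈ F) (hF : F.card = 8) (hbig : ∃ x ∈ F, 2 ≤ x.card)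
    (hdeg2 : ∀ c : Fin h, (F.filter fun x => c ∈ x).card ≠ 2)
    (hdeg4 : ∀ c : Fin h, (F.filter fun x => c ∈ x).card ≠ 4) :
    ∃ a b c d : Fin h, a ≠ b ∧ a ≠ c ∧ b ≠ c ∧ d ≠ a ∧ d ≠ b ∧ d ≠ c ∧
      ∀ y ∈ F, y = ∅ ∨ y = {a} ∨ y = {b} ∨ y = {c} ∨ y = {d} ∨ y = {a, b} ∨ y = {a, c} ∨
        y = {b, c} := by
  classical
  -- no member of size three (its vertices would have degree four)
  have hle2 : ∀ x ∈ F, x.card ≤ 2 := by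
    intro x hx
    by_contra hlt
    push Not at hlt
    obtain ⟨S, hS3, hFS⟩ := eq_powerset_of_three_le_card F hlow (by omega) x hx (by omega)
    obtain ⟨a, haS⟩ : S.Nonempty := by rw [← Finset.card_pos, hS3]; omega
    apply hdeg4 a
    rw [hFS]
    -- subsets of S avoiding a: the power set of S.erase a (four of them); the rest contain a
    have hnot : (S.powerset.filter fun t => ¬ a ∈ t) = (S.erase a).powerset := by
      ext t
      rw [Finset.mem_filter, Finset.mem_powerset, Finset.mem_powerset, Finset.subset_erase]
    have hsum := Finset.card_filter_add_card_filter_not (s := S.powerset) (fun t => a ∈ t)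
    rw [hnot, Finset.card_powerset, Finset.card_powerset, Finset.card_erase_of_mem haS, hS3] at hsum
    omega
  obtain ⟨x, hxF, hx2⟩ := hbig
  obtain ⟨a, b, hab, rfl⟩ := Finset.card_eq_two.mp (le_antisymm (hle2 x hxF) hx2)
  obtain ⟨hPF, hPcard, hsing⟩ := pair_frame F hlow a b hab hxF
  set P : Finset (Finset (Fin h)) := {∅, {a}, {b}, {a, b}} with hPdef
  have hPmem : ∀ y, y ∈ P ↔ y = ∅ ∨ y = {a} ∨ y = {b} ∨ y = {a, b} := by
    intro y; simp only [hPdef, Finset.mem_insert, Finset.mem_singleton]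
  obtain ⟨c, hca, hcb, hacF, honly_a⟩ :=
    third_pair_of_no_degree_two_four F hlow hF hle2 hdeg2 hdeg4 a b hab hxF
  obtain ⟨d, hdb, hda, hbdF, honly_b⟩ := third_pair_of_no_degree_two_four F hlow hF hle2 hdeg2 hdeg4
    b a hab.symm (by rw [Finset.pair_comm]; exact hxF)
  have hcF : ({c} : Finset (Fin h)) ∈ F := hlow _ hacF _ (by simp)
  have hdF : ({d} : Finset (Fin h)) ∈ F := hlow _ hbdF _ (by simp)
  have haF : ({a} : Finset (Fin h)) ∈ F := hPF (by rw [hPmem]; simp)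
  have hbF : ({b} : Finset (Fin h)) ∈ F := hPF (by rw [hPmem]; simp)
  have heF : (∅ : Finset (Fin h)) ∈ F := hPF (by rw [hPmem]; simp)
  -- counting: three members through a, three through b, one through both, so three through neither
  set Fa := F.filter fun y => a ∈ y with hFa
  set Fb := F.filter fun y => b ∈ y with hFb
  set M0 := F.filter fun y => ¬ (a ∈ y ∨ b ∈ y) with hM0
  have hFa3 : Fa.card = 3 := by
    have : Fa = {{a}, {a, b}, {a, c}} := by
      ext y
      rw [hFa, Finset.mem_filter]
      simp only [Finset.mem_insert, Finset.mem_singleton]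
      constructor
      · rintro ⟨hyF, hay⟩; exact honly_a y hyF hay
      · rintro (rfl | rfl | rfl)
        · exact ⟨haF, by simp⟩
        · exact ⟨hxF, by simp⟩
        · exact ⟨hacF, by simp⟩
    rw [this, Finset.card_insert_of_notMem, Finset.card_pair]
    · intro e
      have : b ∈ ({a, c} : Finset (Fin h)) := by rw [← e]; simp
      simp only [Finset.mem_insert, Finset.mem_singleton] at this
      rcases this with h1 | h1
      · exact hab h1.symm
      · exact hcb h1.symm
    · simp only [Finset.mem_insert, Finset.mem_singleton, not_or]
      refine ⟨fun e => ?_, fun e => ?_⟩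
      · have : b ∈ ({a} : Finset (Fin h)) := by rw [e]; simp
        exact hab (Finset.mem_singleton.mp this).symm
      · have : c ∈ ({a} : Finset (Fin h)) := by rw [e]; simp
        exact hca (Finset.mem_singleton.mp this)
  have hFb3 : Fb.card = 3 := by
    have : Fb = {{b}, {b, a}, {b, d}} := by
      ext y
      rw [hFb, Finset.mem_filter]
      simp only [Finset.mem_insert, Finset.mem_singleton]
      constructor
      · rintro ⟨hyF, hby⟩; exact honly_b y hyF hby
      · rintro (rfl | rfl | rfl)
        · exact ⟨hbF, by simp⟩
        · exact ⟨by rw [Finset.pair_comm]; exact hxF, by simp⟩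
        · exact ⟨hbdF, by simp⟩
    rw [this, Finset.card_insert_of_notMem, Finset.card_pair]
    · intro e
      have : a ∈ ({b, d} : Finset (Fin h)) := by rw [← e]; simp
      simp only [Finset.mem_insert, Finset.mem_singleton] at this
      rcases this with h1 | h1
      · exact hab h1
      · exact hda h1.symm
    · simp only [Finset.mem_insert, Finset.mem_singleton, not_or]
      refine ⟨fun e => ?_, fun e => ?_⟩
      · have : a ∈ ({b} : Finset (Fin h)) := by rw [e]; simp
        exact hab (Finset.mem_singleton.mp this)
      · have : d ∈ ({b} : Finset (Fin h)) := by rw [e]; simp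
        exact hdb (Finset.mem_singleton.mp this)
  have hFab : (Fa ∩ Fb).card = 1 := by
    have : Fa ∩ Fb = {{a, b}} := by
      ext y
      rw [Finset.mem_inter, hFa, hFb, Finset.mem_filter, Finset.mem_filter, Finset.mem_singleton]
      constructor
      · rintro ⟨⟨hyF, hay⟩, -, hby⟩
        rcases honly_a y hyF hay with rfl | rfl | rfl
        · simp only [Finset.mem_singleton] at hby; exact absurd hby hab.symm
        · rfl
        · simp only [Finset.mem_insert, Finset.mem_singleton] at hby
          rcases hby with h1 | h1
          · exact absurd h1 hab.symm
          · exact absurd h1.symm hcb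
      · rintro rfl
        exact ⟨⟨hxF, by simp⟩, hxF, by simp⟩
    rw [this, Finset.card_singleton]
  have hunion : (Fa ∪ Fb).card = 5 := by
    have := Finset.card_union_add_card_inter Fa Fb
    omega
  have hM0eq : M0 = F.filter fun y => ¬ y ∈ Fa ∪ Fb := by
    ext y
    rw [hM0, Finset.mem_filter, Finset.mem_filter, Finset.mem_union, hFa, hFb, Finset.mem_filter,
      Finset.mem_filter]
    constructor
    · rintro ⟨hyF, hn⟩
      exact ⟨hyF, fun h' => hn (h'.elim (fun h1 => Or.inl h1.2) (fun h1 => Or.inr h1.2))⟩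
    · rintro ⟨hyF, hn⟩
      exact ⟨hyF, fun h' => hn (h'.elim (fun h1 => Or.inl ⟨hyF, h1⟩) (fun h1 => Or.inr ⟨hyF, h1⟩))⟩
  have hM03 : M0.card = 3 := by
    have hsub : Fa ∪ Fb ⊆ F := by
      intro y hy
      rw [Finset.mem_union, hFa, hFb, Finset.mem_filter, Finset.mem_filter] at hy
      rcases hy with h1 | h1
      · exact h1.1
      · exact h1.1
    have hin : (F.filter fun y => y ∈ Fa ∪ Fb) = Fa ∪ Fb := by
      ext y
      rw [Finset.mem_filter]
      exact ⟨fun h' => h'.2, fun h' => ⟨hsub h', h'⟩⟩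
    have hsum := Finset.card_filter_add_card_filter_not (s := F) (fun y => y ∈ Fa ∪ Fb)
    rw [hin, hunion, hF, ← hM0eq] at hsum
    omega
  have hM0mem : ∀ y, y ∈ M0 ↔ y ∈ F ∧ a ∉ y ∧ b ∉ y := by
    intro y; rw [hM0, Finset.mem_filter, not_or]
  have heM : (∅ : Finset (Fin h)) ∈ M0 := (hM0mem _).mpr ⟨heF, by simp, by simp⟩
  have hcM : ({c} : Finset (Fin h)) ∈ M0 :=
    (hM0mem _).mpr ⟨hcF, by rw [Finset.mem_singleton]; exact fun e => hca e.symm,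
      by rw [Finset.mem_singleton]; exact fun e => hcb e.symm⟩
  have hdM : ({d} : Finset (Fin h)) ∈ M0 :=
    (hM0mem _).mpr ⟨hdF, by rw [Finset.mem_singleton]; exact fun e => hda e.symm,
      by rw [Finset.mem_singleton]; exact fun e => hdb e.symm⟩
  -- c = d
  have hcd : c = d := by
    by_contra hcd
    have hM0' : M0 = {∅, {c}, {d}} := by
      symm
      apply Finset.eq_of_subset_of_card_le
      · intro t ht
        simp only [Finset.mem_insert, Finset.mem_singleton] at ht
        rcases ht with rfl | rfl | rfl
        · exact heM
        · exact hcM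
        · exact hdM
      · rw [hM03, Finset.card_insert_of_notMem, Finset.card_pair]
        · exact fun e => hcd (Finset.singleton_injective e)
        · simp only [Finset.mem_insert, Finset.mem_singleton, not_or]
          exact ⟨(Finset.singleton_ne_empty c).symm, (Finset.singleton_ne_empty d).symm⟩
    apply hdeg2 c
    have : (F.filter fun y => c ∈ y) = {{c}, {a, c}} := by
      ext y
      simp only [Finset.mem_filter, Finset.mem_insert, Finset.mem_singleton]
      constructor
      · rintro ⟨hyF, hcy⟩
        by_cases hay : a ∈ y
        · rcases honly_a y hyF hay with rfl | rfl | rfl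
          · simp only [Finset.mem_singleton] at hcy; exact absurd hcy hca
          · simp only [Finset.mem_insert, Finset.mem_singleton] at hcy
            rcases hcy with e | e
            · exact absurd e hca
            · exact absurd e hcb
          · exact Or.inr rfl
        · by_cases hby : b ∈ y
          · rcases honly_b y hyF hby with rfl | rfl | rfl
            · simp only [Finset.mem_singleton] at hcy; exact absurd hcy hcb
            · simp only [Finset.mem_insert, Finset.mem_singleton] at hcy
              rcases hcy with e | e
              · exact absurd e hcb
              · exact absurd e hca
            · simp only [Finset.mem_insert, Finset.mem_singleton] at hcy
              rcases hcy with e | e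
              · exact absurd e hcb
              · exact absurd e hcd
          · have hyM : y ∈ M0 := (hM0mem _).mpr ⟨hyF, hay, hby⟩
            rw [hM0'] at hyM
            simp only [Finset.mem_insert, Finset.mem_singleton] at hyM
            rcases hyM with rfl | rfl | rfl
            · simp at hcy
            · exact Or.inl rfl
            · simp only [Finset.mem_singleton] at hcy; exact absurd hcy hcd
      · rintro (rfl | rfl)
        · exact ⟨hcF, by simp⟩
        · exact ⟨hacF, by simp⟩
    rw [this, Finset.card_pair]
    intro e
    have := congrArg Finset.card e
    rw [Finset.card_singleton, Finset.card_pair (fun e' => hca e'.symm)] at this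
    omega
  subst hcd
  -- the third member of M0 is a singleton {e}
  obtain ⟨t₀, ht₀, ht₀n⟩ : ∃ t₀ ∈ M0, t₀ ∉ ({∅, {c}} : Finset (Finset (Fin h))) := by
    by_contra hno
    push Not at hno
    have := Finset.card_le_card (show M0 ⊆ {∅, {c}} from hno)
    rw [hM03] at this
    have h2 : ({∅, {c}} : Finset (Finset (Fin h))).card ≤ 2 := Finset.card_le_two
    omega
  simp only [Finset.mem_insert, Finset.mem_singleton, not_or] at ht₀n
  obtain ⟨ht₀F, hat₀, hbt₀⟩ := (hM0mem _).mp ht₀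
  have hM0' : M0 = {∅, {c}, t₀} := by
    symm
    apply Finset.eq_of_subset_of_card_le
    · intro t ht
      simp only [Finset.mem_insert, Finset.mem_singleton] at ht
      rcases ht with rfl | rfl | rfl
      · exact heM
      · exact hcM
      · exact ht₀
    · rw [hM03, Finset.card_insert_of_notMem, Finset.card_pair (fun e => ht₀n.2 e.symm)]
      simp only [Finset.mem_insert, Finset.mem_singleton, not_or]
      exact ⟨(Finset.singleton_ne_empty c).symm, fun e => ht₀n.1 e.symm⟩
  -- every element of t₀ other than c has its singleton in M0, hence t₀ = {e} with e ≠ c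
  have helem : ∀ e ∈ t₀, e ≠ c → t₀ = {e} := by
    intro e he hec
    have heF' : ({e} : Finset (Fin h)) ∈ F := hlow _ ht₀F _ (Finset.singleton_subset_iff.mpr he)
    have hea : e ≠ a := fun e' => hat₀ (e' ▸ he)
    have heb : e ≠ b := fun e' => hbt₀ (e' ▸ he)
    have heM' : ({e} : Finset (Fin h)) ∈ M0 :=
      (hM0mem _).mpr ⟨heF', by rw [Finset.mem_singleton]; exact fun e' => hea e'.symm,
        by rw [Finset.mem_singleton]; exact fun e' => heb e'.symm⟩
    rw [hM0'] at heM'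
    simp only [Finset.mem_insert, Finset.mem_singleton] at heM'
    rcases heM' with e' | e' | e'
    · exact absurd e' (Finset.singleton_ne_empty e)
    · exact absurd (Finset.singleton_injective e') hec
    · exact e'.symm
  have ht₀2 := hle2 t₀ ht₀F
  obtain ⟨e, he⟩ : t₀.Nonempty := Finset.nonempty_iff_ne_empty.mpr ht₀n.1
  have hte : t₀ = {e} := by
    by_cases hec : e = c
    · subst hec
      -- t₀ ∋ c, t₀ ≠ {c}: a second element f ≠ c, then t₀ = {f}, contradiction
      exfalso
      obtain ⟨f, hf, hfn⟩ : ∃ f ∈ t₀, f ∉ ({e} : Finset (Fin h)) := by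
        by_contra hno
        push Not at hno
        exact ht₀n.2 (Finset.eq_singleton_iff_unique_mem.mpr ⟨he, fun f hf =>
          Finset.mem_singleton.mp (hno f hf)⟩)
      rw [Finset.mem_singleton] at hfn
      have := helem f hf hfn
      rw [this, Finset.mem_singleton] at he
      exact hfn he.symm
    · exact helem e he hec
  subst hte
  have hec : e ≠ c := fun e' => ht₀n.2 (by rw [e'])
  have hea : e ≠ a := fun e' => hat₀ (by rw [e']; simp)
  have heb : e ≠ b := fun e' => hbt₀ (by rw [e']; simp)
  refine ⟨a, b, c, e, hab, hca.symm, hcb.symm, hea, heb, hec, fun y hy => ?_⟩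
  by_cases hay : a ∈ y
  · rcases honly_a y hy hay with h1 | h1 | h1
    · exact Or.inr (Or.inl h1)
    · exact Or.inr (Or.inr (Or.inr (Or.inr (Or.inr (Or.inl h1)))))
    · exact Or.inr (Or.inr (Or.inr (Or.inr (Or.inr (Or.inr (Or.inl h1))))))
  · by_cases hby : b ∈ y
    · rcases honly_b y hy hby with h1 | h1 | h1
      · exact Or.inr (Or.inr (Or.inl h1))
      · exact Or.inr (Or.inr (Or.inr (Or.inr (Or.inr (Or.inl (h1.trans (Finset.pair_comm _ _)))))))
      · exact Or.inr (Or.inr (Or.inr (Or.inr (Or.inr (Or.inr (Or.inr h1))))))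
    · have hyM : y ∈ M0 := (hM0mem _).mpr ⟨hy, hay, hby⟩
      rw [hM0'] at hyM
      simp only [Finset.mem_insert, Finset.mem_singleton] at hyM
      rcases hyM with h1 | h1 | h1
      · exact Or.inl h1
      · exact Or.inr (Or.inr (Or.inr (Or.inl h1)))
      · exact Or.inr (Or.inr (Or.inr (Or.inr (Or.inl h1))))

end Summit.ValiantsHypothesis.ValiantsHypothesis.Theorems.BarrierLever.FiniteCheck
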